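/-
Copyright (c) 2026 the pub-hodgecm-mathlib formalisation cell (harness21).  Prover seat hodgecm-mathlib-F0P3a-p04 (g35): P6b wave B
row (g1) «TRANSLATION BY A CLOSED SUBGROUP SCHEME IS A FREE ACTION» of DEALS v8 (interim dealer desk F0P6d-plan (g8), LEAD F0P6-plan
(g8) «M-152x», heir desk F0P6b-plan (g14)); box LA-ref2 (g7), 2026-09-03.
-/
import Mathlib.CategoryTheory.Limits.Shapes.Pullback.IsPullback.Defs
import Mathlib.CategoryTheory.Limits.Constructions.Over.Connected
import Literature.AlgebraicGeometry.GroupSchemes.GroupSchemeActionProperFree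
import Literature.AlgebraicGeometry.GroupSchemes.GrpObjShear
import HarnessLib

/-!
# Translation by a closed subgroup scheme is a free action

Topic `AlgebraicGeometry/GroupSchemes`; namespace `Literature.AlgebraicGeometry.GroupSchemes.TranslationAction` (sub-namespace = the
object).  THEOREMS ONLY (no definition, instance, notation or named fact), Mathlib-footed (`GrpObj`, `ModObj`, `IsPullback`,
`IsClosedImmersion`) over ★ `GroupSchemes/GroupSchemeActionProperFree` (`shear`, `IsFreeAction` = [MumfordFogartyKirwan1994] Def. 0.8 (iv))
and ★ `GroupSchemes/GrpObjShear` (`isIso_lift_mul_snd`: the right shear `(x, y) ↦ (x·y, y)` of a group object is an isomorphism).  Cell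
`pub/hodgecm-mathlib` (D-0151), wave-B row (g1) of the §Q fan-out (`CENSUS-Q-junction.v1`, socket §Q `stub_L4B1uQ_quotientByFiniteFlatSubgroup`
of `Cruxes/HLiu418/Lines/F0_P6b_MumfordDualFlat.lean`); lane `--supports stmt-HodgeConjecture-24832`; count-neutral (banked Row-4B capital).  HC_CM is
proved only modulo the printed citations (2 remaining named inputs hLiu418 = `stmt-HodgeConjecture-24832`, h413 = `stmt-HodgeConjecture-24833`) until
rung 0 closes.

THE STATEMENT ([MumfordAV1970] §12 p. 109 «if `H ⊂ G` is a closed subgroup scheme, the action of `H` on `G` by translation is free»;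
[MumfordFogartyKirwan1994] Ch. 0 §3 Def. 0.8 (iv); [SGA3I] Exp. V §2 (b)).  `S` a scheme, `A` an `S`-group scheme, `i : Z ⟶ A` a morphism of
`S`-schemes which is a CLOSED IMMERSION on underlying schemes (no group structure on `Z` is needed for the geometry), `act := (i ▷ A) ≫ μ[A] :
Z ×_S A → A` the left translation.  THEN
* `isClosedImmersion_lift_act_snd_left` — **`(act, pr₂) : Z ×_S A → A ×_S A` is a closed immersion** (it is `(i × 𝟙) : Z ×_S A ↪ A ×_S A`
  followed by the right shear ISOMORPHISM `Ψ = (μ, pr₂)` of `A`); this is the `ModObj`-free spelling consumed by the separatedness of the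
  quotient (row (8): `A ×_{A⁄Z} A ≅ Z ×_S A ↪ A ×_S A` closed);
* `isFreeAction_of_isClosedImmersion_left` — for ANY `ModObj Z A` whose action morphism is `γ[Z, A] = (i ▷ A) ≫ μ[A]` (however row (g2) builds it),
  **`IsFreeAction Z A`** (Def. 0.8 (iv): `Ψ_Z = (γ, pr₂)` is a closed immersion) — the `hfree` input of the chart coaction (row (2-I)); its
  restriction to a `Z`-stable open is then ★ `ActionRestrict.isFreeAction_open` ∕ `IsFreeAction.restrict` (not retyped here).
* On the way (any cartesian monoidal category `C`): `isPullback_whiskerRight_fst` — **`f ▷ X` is the base change of `f` along `fst`**: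
  the square `(f ▷ X, fst; fst, f)` is cartesian; hence in `Over S` (`Over.forget` preserves connected limits) `isPullback_whiskerRight_fst_left` and
  `isClosedImmersion_whiskerRight_left` — `(i ▷ X).left` is a closed immersion when `i.left` is (closed immersions are stable under base change);
  `lift_act_snd_eq` — `(act, pr₂) = (i ▷ A) ≫ Ψ_A`.

## References
* [MumfordAV1970] D. Mumford, *Abelian Varieties* (1970), §12 «Quotients by finite group schemes», p. 109 (free actions; translation by a closed
  subgroup scheme) and Thm. 1 p. 111.
* [MumfordFogartyKirwan1994] D. Mumford, J. Fogarty, F. Kirwan, *GIT*, 3rd ed. (1994), Ch. 0 §3 Def. 0.8 (iv) (pp. 9–10); Ch. 0 §1 (p. 2).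
* [SGA3I] M. Demazure, A. Grothendieck (eds.), *SGA 3, Tome I*, Exp. V §2; Exp. I 2.3.3.
* [BLRNeronModels1990] S. Bosch, W. Lütkebohmert, M. Raynaud, *Néron Models* (1990), §5.1 Def. 1 (the shear maps `Φ`, `Ψ`).
-/

set_option autoImplicit false

noncomputable section

universe v u

open CategoryTheory CategoryTheory.Limits MonoidalCategory CartesianMonoidalCategory
open scoped MonObj

namespace Literature.AlgebraicGeometry.GroupSchemes.TranslationAction

/-! ## §1  Any cartesian monoidal category: `f ▷ X` is a base change of `f`; `(act, pr₂)` factors through the shear -/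

section General

variable {C : Type u} [Category.{v} C] [CartesianMonoidalCategory C]

/-- **`f ▷ X` is the base change of `f` along the first projection**: for `f : Z ⟶ A` and any object `X` the square
`Z ⊗ X —(f ▷ X)→ A ⊗ X`, `fst ↓ ↓ fst`, `Z —f→ A` is CARTESIAN (on points: a pair `((a, x), z)` with `f z = a` is the point `(z, x)`).
[cite: MumfordFogartyKirwan1994, Ch. 0 §1 (p. 2)] -/
theorem isPullback_whiskerRight_fst {Z A : C} (f : Z ⟶ A) (X : C) :
    IsPullback (f ▷ X) (fst Z X) (fst A X) f := by
  refine IsPullback.of_isLimit' ⟨whiskerRight_fst f X⟩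
    (PullbackCone.IsLimit.mk _ (fun s => lift s.snd (s.fst ≫ snd A X))
      (fun s => ?_) (fun s => ?_) (fun s m hm₁ hm₂ => ?_))
  · rw [lift_whiskerRight, ← s.condition, lift_comp_fst_snd]
  · exact lift_fst _ _
  · refine CartesianMonoidalCategory.hom_ext _ _ ?_ ?_
    · rw [lift_fst, ← hm₂]
    · rw [lift_snd, ← hm₁, Category.assoc, whiskerRight_snd]

variable {Z A : C} [GrpObj A] (i : Z ⟶ A)

/-- **`(act, pr₂) = (i × 𝟙) ≫ Ψ_A`**: the graph morphism of the left translation `act = (i ▷ A) ≫ μ` is the whiskering `i ▷ A` followed by the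
right shear `Ψ_A = (μ, pr₂)` of `A`. [cite: BLRNeronModels1990, §5.1 Def. 1 and §4.3] -/
theorem lift_act_snd_eq :
    lift ((i ▷ A) ≫ μ[A]) (snd Z A) = (i ▷ A) ≫ lift μ[A] (snd A A) := by
  rw [comp_lift, whiskerRight_snd]

/-- On `T`-valued points `(act, pr₂)` is `(v, u) ↦ ((v ≫ i) * u, u)`. [cite: MumfordFogartyKirwan1994, Ch. 0 §3, Def. 0.8 (pp. 9–10)] -/
theorem lift_comp_lift_act_snd {T : C} (v : T ⟶ Z) (u : T ⟶ A) :
    lift v u ≫ lift ((i ▷ A) ≫ μ[A]) (snd Z A) = lift ((v ≫ i) * u) u := by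
  rw [comp_lift, lift_snd, ← Category.assoc, lift_whiskerRight, Hom.mul_def]

end General

/-! ## §2  Schemes: `(i ▷ X).left` and `(act, pr₂).left` are closed immersions -/

section Scheme

open _root_.AlgebraicGeometry

variable {S : Scheme.{u}} {Z A : Over S} (i : Z ⟶ A)

/-- The underlying square of schemes of `isPullback_whiskerRight_fst` (`Over.forget` preserves pullbacks): `(i ▷ X).left : Z ×_S X → A ×_S X`
is the base change of `i.left` along `pr₁ : A ×_S X → A`. [cite: MumfordFogartyKirwan1994, Ch. 0 §1 (p. 2)] -/
theorem isPullback_whiskerRight_fst_left (X : Over S) :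
    IsPullback (i ▷ X).left (fst Z X).left (fst A X).left i.left :=
  (isPullback_whiskerRight_fst i X).map (Over.forget S)

/-- **`i × 𝟙 : Z ×_S X ↪ A ×_S X` is a closed immersion when `i` is** (closed immersions are stable under base change, Mathlib).
[cite: MumfordFogartyKirwan1994, Ch. 0 §3, Def. 0.8 (pp. 9–10)] -/
theorem isClosedImmersion_whiskerRight_left [IsClosedImmersion i.left] (X : Over S) :
    IsClosedImmersion (i ▷ X).left :=
  MorphismProperty.of_isPullback (P := @IsClosedImmersion) (isPullback_whiskerRight_fst_left i X).flip ‹_›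

variable [GrpObj A]

/-- **`(act, pr₂) : Z ×_S A → A ×_S A` IS A CLOSED IMMERSION for the translation action of a closed sub-scheme `i : Z ↪ A` of a group scheme**
([MumfordAV1970] §12 p. 109: translation by a closed subgroup scheme is a free action): it is the closed immersion `i × 𝟙` followed by the shear
isomorphism `Ψ_A = (μ, pr₂)` (★ `isIso_lift_mul_snd`).  The `ModObj`-free spelling — no group structure on `Z` is used.
[cite: MumfordAV1970, §12 (p. 109) and Thm. 1 (p. 111)] [cite: MumfordFogartyKirwan1994, Ch. 0 §3, Def. 0.8 (iv) (pp. 9–10)] -/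
theorem isClosedImmersion_lift_act_snd_left [IsClosedImmersion i.left] :
    IsClosedImmersion (lift ((i ▷ A) ≫ μ[A]) (snd Z A)).left := by
  rw [lift_act_snd_eq, Over.comp_left]
  haveI := isClosedImmersion_whiskerRight_left i A
  haveI : IsIso (lift μ[A] (snd A A)) := isIso_lift_mul_snd A
  haveI : IsIso (lift μ[A] (snd A A)).left := inferInstanceAs (IsIso ((Over.forget S).map (lift μ[A] (snd A A))))
  infer_instance

/-- **TRANSLATION BY A CLOSED SUBGROUP SCHEME IS A FREE ACTION** ([MumfordAV1970] §12 p. 109; [MumfordFogartyKirwan1994] Def. 0.8 (iv)): for any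
action structure of `Z` on `A` whose action morphism is the left translation through `i` (`γ[Z, A] = (i ▷ A) ≫ μ[A]`), the action is FREE —
`Ψ_Z = (γ, pr₂) : Z ×_S A → A ×_S A` is a closed immersion.  (Its restriction to any `Z`-stable open stays free: ★ `ActionRestrict.isFreeAction_open`.)
[cite: MumfordAV1970, §12 (p. 109) and Thm. 1 (p. 111)] [cite: MumfordFogartyKirwan1994, Ch. 0 §3, Def. 0.8 (iv) (pp. 9–10)] -/
theorem isFreeAction_of_isClosedImmersion_left [IsClosedImmersion i.left] [GrpObj Z] [σ : ModObj Z A]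
    (hγ : γ[Z, A] = (i ▷ A) ≫ μ[A]) : IsFreeAction Z A := by
  rw [isFreeAction_iff]
  have h : shear Z A = lift ((i ▷ A) ≫ μ[A]) (snd Z A) :=
    CartesianMonoidalCategory.hom_ext _ _ (by rw [shear_fst, lift_fst, hγ]) (by rw [shear_snd, lift_snd])
  rw [h]
  exact isClosedImmersion_lift_act_snd_left i

/-- **Trivial stabilisers**: for the translation action through a closed immersion, `(v ≫ i) * u = u` forces `v = 1` on `T`-valued points
(★ `IsFreeAction.eq_one_of_smul_eq`, spelled without `•`). [cite: MumfordFogartyKirwan1994, Ch. 0 §3, Def. 0.8 (iv) (pp. 9–10)] -/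
theorem eq_one_of_mul_eq [IsClosedImmersion i.left] [GrpObj Z] [σ : ModObj Z A]
    (hγ : γ[Z, A] = (i ▷ A) ≫ μ[A]) {T : Over S} {v : T ⟶ Z} {u : T ⟶ A} (h : (v ≫ i) * u = u) : v = 1 := by
  refine (isFreeAction_of_isClosedImmersion_left i hγ).eq_one_of_smul_eq (x := u) ?_
  rw [Hom.smul_def, hγ, ← Category.assoc, lift_whiskerRight, ← Hom.mul_def, h]

end Scheme

end Literature.AlgebraicGeometry.GroupSchemes.TranslationAction

end
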